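import Summits.QuantumFields.QCD.Theorems.SpectralDefectExtinctionWindowExtinctionChessboardDefs
import Literature.MathematicalPhysics.QuantumFieldTheory.LatticeGaugeProofs

/-!
# Crux `WindowExtinction` (stmt-QuantumFields-8964), line `chessboard-cold-cells`, stub S2 `stub_column`:
# the cheap TRUE fragments (audit)

`stub_column` (eight nats per time-invariant flat cube at weak coupling, uniformly in the odd torus) is a
Chatterjee-type weak-coupling small-ball large deviation for the `SU(3)` Wilson measure and is OPEN; this
file records the elementary facts around it that ARE provable now:

* `columnEvent_measure_le_one` — the priced event always has Wilson probability `≤ 1`;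
* `stub_column_empty` — the `X = ∅` instance of `stub_column` (both sides equal `1`), for every `β`, `S`;
* `cubeFlat_of_forall_mulVec_eq` — the disprover's flank made precise: a spatial 3-cube all of whose twelve
  links fix a common non-zero colour vector (e.g. `SU(2) ⊂ SU(3)`-valued links, or the trivial configuration)
  is EXACTLY flat, hence `θ`-flat at every level `θ ≥ 0`; in particular (`cubeFlat_one`) the priced event
  is never empty, so `stub_column` is a genuine quantitative (non-vacuous) large-deviation claim.
-/

noncomputable section

namespace Summit.QuantumFields.QCD.Cruxes.WindowExtinction.ChessboardColdCells

open scoped BigOperators Matrix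
open MeasureTheory Literature.MathematicalPhysics.QuantumLattice Literature.MathematicalPhysics.QuantumFieldTheory
  Literature.Probability.LatticeModels

/-- The time-invariant flat-column event has Wilson probability at most `1` (the Wilson measure of the
fundamental `SU(3)` theory on the odd four-torus is a probability measure). -/
theorem columnEvent_measure_le_one (β θ : ℝ) (S : ℕ) (X : Finset (Fin 3 → ZMod (2 * S + 1))) :
    (wilsonMeasure (d := 4) (L := 2 * S + 1) (fundamentalRep (Fin 3)) β)
        {U | ∀ xs ∈ X, ∀ t : ZMod (2 * S + 1), CubeFlat U (siteOf t xs) θ} ≤ 1 := by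
  haveI := isProbabilityMeasure_wilsonMeasure (d := 4) (L := 2 * S + 1) (fundamentalRep (Fin 3))
    (continuous_fundamentalRep (Fin 3)) β
  exact prob_le_one

/-- **The `X = ∅` case of `stub_column`** (no cube is constrained: the event is everything and the price is
`e^{-8·0} = 1`), valid for every `β` and every `S`. -/
theorem stub_column_empty : ∀ (β : ℝ) (S : ℕ),
    (wilsonMeasure (d := 4) (L := 2 * S + 1) (fundamentalRep (Fin 3)) β)
        {U | ∀ xs ∈ (∅ : Finset (Fin 3 → ZMod (2 * S + 1))), ∀ t : ZMod (2 * S + 1),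
          CubeFlat U (siteOf t xs) (flatLevel / β)}
      ≤ ENNReal.ofReal (Real.exp (-8) ^ ((2 * S + 1) * (∅ : Finset (Fin 3 → ZMod (2 * S + 1))).card)) := by
  intro β S
  rw [Finset.card_empty, mul_zero, pow_zero, ENNReal.ofReal_one]
  exact columnEvent_measure_le_one β _ S ∅

/-- **Stabilised cubes are exactly flat.** If the twelve spatial links of the unit 3-cube with lowest corner
`y` all fix a common non-zero colour vector `e` (e.g. all of them lie in the `SU(2) ⊂ SU(3)` stabilising
`e`, or are trivial), the constant field `v ≡ e` has zero covariant Dirichlet energy, so the cube is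
`θ`-flat at every level `θ ≥ 0` — the cheapest known mechanism for TOTAL flatness of a time slice. -/
theorem cubeFlat_of_forall_mulVec_eq {L : ℕ} (U : GaugeConfig 4 L SU3) (y : TorusSite 4 L)
    {e : Fin 3 → ℂ} (he : e ≠ 0)
    (hfix : ∀ s : Fin 3 → Fin 2, ∀ i : Fin 3, (fundamentalRep (Fin 3) (U (corner y s, i.succ))) *ᵥ e = e)
    {θ : ℝ} (hθ : 0 ≤ θ) : CubeFlat U y θ := by
  refine ⟨fun _ => e, ?_, ?_⟩
  · intro h
    exact he (congr_fun h (fun _ => 0))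
  · have hE : cubeEnergy U y (fun _ => e) = 0 := by
      simp only [cubeEnergy, hfix, sub_self, norm_zero, ne_eq, OfNat.ofNat_ne_zero, not_false_eq_true,
        zero_pow, Finset.sum_const_zero, ite_self, mul_zero]
    rw [hE]
    exact mul_nonneg hθ (cubeMass_nonneg _)

/-- In the trivial configuration every spatial 3-cube is `θ`-flat for every `θ ≥ 0`; in particular the event
priced by `stub_column` is non-empty for `β > 0`. -/
theorem cubeFlat_one {L : ℕ} (y : TorusSite 4 L) {θ : ℝ} (hθ : 0 ≤ θ) :
    CubeFlat (1 : GaugeConfig 4 L SU3) y θ :=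
  cubeFlat_of_forall_mulVec_eq 1 y (e := fun _ => 1) (by simp [funext_iff])
    (fun s i => by simp [Matrix.one_mulVec]) hθ

end Summit.QuantumFields.QCD.Cruxes.WindowExtinction.ChessboardColdCells

end
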